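import Summits.BirchSwinnertonDyer.BirchSwinnertonDyer.Theses.GenusKolyvaginAtTwo
import Summits.BirchSwinnertonDyer.BirchSwinnertonDyer.Theorems.ByReductionTypeAtTwoRankOneAtTwoOneDoorFirstDescentDefs
import Summits.BirchSwinnertonDyer.BirchSwinnertonDyer.Theorems.GenusKolyvaginAtTwoVisiblePairAtTwoClassesOfHeegner
import Summits.BirchSwinnertonDyer.BirchSwinnertonDyer.Theorems.GenusKolyvaginAtTwoVisiblePairAtTwoHeegnerClassKummer
import Summits.BirchSwinnertonDyer.BirchSwinnertonDyer.Theorems.KolyvaginRoadThreeLevelData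
import Summits.BirchSwinnertonDyer.BirchSwinnertonDyer.Theorems.Rank1ResidualJetCompatibleDataDown
import Literature.NumberTheory.EllipticCurves.HeegnerPointsOfConductorOneGaloisConjProofs
import Literature.NumberTheory.EllipticCurves.HeegnerPointsOfConductorRationalityProofs
import Literature.NumberTheory.EllipticCurves.RingClassGalOverCyclicProofs
import Literature.NumberTheory.EllipticCurves.BSDRankZeroDensity
import HarnessLib

/-!
# Route ByReductionTypeAtTwo, crux `RankOneAtTwoBigImageOddLocal` (stmt-BirchSwinnertonDyer-23715), LINE v8.10 `one_door_analytic`: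
# the FIRST-LAYER DATA of the bottom rung at `Δ_W < 0` — a compatible pair of Kolyvagin–Heegner data `(d₁, d_ℓ)`, the bottom class
# `c(1) = κ_K(P)`, the `±`-descents of `c(ℓ)` at level `2`, and Gross 6.2 (2) at `λ ∣ ℓ` READ OFF route GenusKolyvaginAtTwo's item
# 24880 `KolyvaginRelationAtTwo` at `(M, m, l) = (1, 1, ℓ)`

Lead prover seat `bsd-line-fkl-p1` g13 (2026-08-28), `--supports stmt-BirchSwinnertonDyer-23715` (helper).  THEOREMS ONLY; no definition,
no named fact introduced, no `sorry`; BSD is not proved by any of this.  The one displayed input is the route decl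
`Theses.GenusKolyvaginAtTwo.KolyvaginRelationAtTwo` (item 24880; proved in the tree modulo the print fact Gross 1991 Prop. 3.7 (2),
`GenusExact.kolyvaginRelationAtTwo_of_frobeniusCongruence`).

* §1 `exists_levelTransport` — bookkeeping: a class of `H¹(ℚ, X[n])` read at an equal level `m` (`subst`), with its local conditions and
  its Kummer identity; used to pass between the record's level `(2 : ℤ)` and the classes' level `((2 ^ 1 : ℕ) : ℤ)`.
* §2 `exists_kolyvaginHeegnerData_pair` — for a Zhang–Kolyvagin prime `ℓ` at `2`, data `d₁` (conductor `1`) and `d_ℓ` (conductor `1·ℓ`)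
  over one frame `(Dt, β, ι)`, COMPATIBLE in the four clauses of item 24880 (Gross's CM construction `nonempty_kolyvaginHeegnerData_of_grossCM`
  with the two PROVED CM facts, restricted down by `JET.exists_compatible_datum_of_dvd_of_grossCM`).
* §3 `map_algebraMap_eq_derivedPoint_of_heegnerPoint` — for `d₁` over the frame of a Heegner datum `H` (`β = H.β`) and `P ∈ E(K)` over
  `heegnerPointComplex Dt H`: `P ↦ P(1) = d₁.derivedPoint` in `E(K[1])` (Shimura reciprocity at conductor `1`, tree theorem
  `heegnerPointOfConductor_one_galoisConj_holds`, and Galois descent); hence §4 `kolyvaginClass_one_eq_kummerMapTorsion_of_heegnerPoint`: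
  `c_M(1) = κ_{2^M}(P)` (gk2's `kolyvaginClass_one_two_eq_kummerMapTorsion`).
* §5 `conjAct_kolyvaginClass_eq_self_and_eq_neg_two` — at level `2` Kolyvagin's class is BOTH `τ`-fixed and `τ`-anti-fixed (Gross 5.4 at
  `2`, `KolyvaginClassSign.sign_conjAct_kolyvaginClass_two`, and `2c = 0`), so §6 it descends to `H¹(ℚ, W[2])` AND to
  `H¹(ℚ, W^{(d_K)}[2])` (`EigenClassesFinite.existsUnique_resTorsion_eq_of_conjAct_eq` / `…_hPsiKT_…_of_conjAct_eq_neg`).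
* §7 `kolyvaginRelation_at_prime_of_item` — item 24880 at `(1, 1, ℓ)`, `j = 0`: at `λ ∣ ℓ`,
  `(c(ℓ) ∈ Sel_λ ↔ c(ℓ)_λ = 0) ∧ (c(ℓ)_λ = 0 ↔ c(1)_λ = 0)`.

References: [GrossLMS1991] §3–§6 (Props. 3.6, 3.7, 5.4, 6.2), §4 (4.1), (4.4); [McCallumLMS1991] §4 (4)–(6), Lemma 4.3, Prop. 4.4;
[Kolyvagin1989Izv] §3; [Darmon2004] Thm. 3.7; [WZhang2014] Notations (xii).
-/

set_option autoImplicit false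
-- the Theorems namespace of this sub repeats the summit name by design (D-0017 nested layout)
set_option linter.dupNamespace false

noncomputable section

open scoped Classical

namespace Summit.BirchSwinnertonDyer.BirchSwinnertonDyer.Theorems.RankOneAtTwoOneDoor

open WeierstrassCurve NumberField IsDedekindDomain Field
  Literature.NumberTheory.EllipticCurves Literature.NumberTheory.EllipticCurves.ModularForms
  Literature.NumberTheory.GaloisRepresentations Literature.NumberTheory.EllipticCurves.KolyvaginCocycle
  Summit.BirchSwinnertonDyer.Rank1Residual
  Summit.BirchSwinnertonDyer.BirchSwinnertonDyer.Theorems.GenusExact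
  Summit.BirchSwinnertonDyer.BirchSwinnertonDyer.Theorems.GenusExact.VisiblePairAtTwo
  Summit.BirchSwinnertonDyer.BirchSwinnertonDyer.Theorems.GenusExact.EigenClassesFinite
  Summit.BirchSwinnertonDyer.BirchSwinnertonDyer.Theorems.GenusExact.KolyvaginClassSign

/-! ### §1 Bookkeeping: reading a class at an equal level -/

/-- **Reading a class of `H¹(ℚ, X[n])` at an equal level `m = n`**: the same class with the same local conditions at every place and the
same Kummer identity over any `K` (pure bookkeeping by `subst`; used with `((2 ^ 1 : ℕ) : ℤ) = 2`). [folklore] -/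
theorem exists_levelTransport (X : WeierstrassCurve ℚ) {n m : ℤ} (h : n = m) (x : galH1Torsion X n) :
    ∃ x' : galH1Torsion X m,
      (∀ v : RatPlace, x ∈ locAt X n v ↔ x' ∈ locAt X m v) ∧ (∀ v : RatPlace, x ∈ strictAt X n v ↔ x' ∈ strictAt X m v) ∧
      ∀ (K : Type) [Field K] [NumberField K]
        (hd : ∀ Q : geomPoints (X.baseChange K), ∃ R : geomPoints (X.baseChange K), n • R = Q)
        (hd' : ∀ Q : geomPoints (X.baseChange K), ∃ R : geomPoints (X.baseChange K), m • R = Q)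
        (P : (X.baseChange K).toAffine.Point),
        (resTorsion X K n x = kummerMapTorsion (X.baseChange K) n hd P ↔
          resTorsion X K m x' = kummerMapTorsion (X.baseChange K) m hd' P) := by
  subst h
  exact ⟨x, fun _ => Iff.rfl, fun _ => Iff.rfl, fun _ _ _ _ _ _ => Iff.rfl⟩

/-- `((2 ^ 1 : ℕ) : ℤ) = 2` (the level of `kolyvaginClass 2 1`). [folklore] -/
theorem level_two_pow_one : ((2 ^ 1 : ℕ) : ℤ) = 2 := by norm_num

/-! ### §2 A compatible pair of Kolyvagin–Heegner data at conductors `1` and `1·ℓ` -/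

/-- **A COMPATIBLE pair `(d₁, d_ℓ)` of Kolyvagin–Heegner data** over one frame `(Dt, β, ι)` (`4N ∣ β² − d_K`), for `K` imaginary quadratic
with `d_K < −4` and the Heegner hypothesis for `N_W`, and a Zhang–Kolyvagin prime `ℓ` at `2`: data of conductor `1 · ℓ` (Gross's CM
construction, tree `nonempty_kolyvaginHeegnerData_of_grossCM` with the PROVED CM facts `phi_heegnerPointOfConductor_mem_range_map_ringClassField_holds`,
`exists_generator_ringClassGalOver_holds`) and of conductor `1`, compatible in the four clauses of item 24880 (`σ` — vacuous —, `S` both ways,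
`emb`; tree `JET.exists_compatible_datum_of_dvd_of_grossCM`). [cite: GrossLMS1991, §3 (pp. 238–239), §4 (4.1)] [cite: McCallumLMS1991, §4 (p. 300)] -/
theorem exists_kolyvaginHeegnerData_pair (W : WeierstrassCurve ℚ) [W.IsElliptic] [W.IsGloballyMinimal] [NeZero (W.conductorNorm ℤ)]
    (K : Type) [Field K] [NumberField K] (hK : IsImaginaryQuadratic K) (hD : NumberField.discr K < -4)
    (hH : SatisfiesHeegnerHypothesis (W.conductorNorm ℤ) K)
    (Dt : ModularParametrizationData W (W.conductorNorm ℤ)) (β : ℤ)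
    (hβ : (4 * (W.conductorNorm ℤ : ℕ) : ℤ) ∣ β ^ 2 - NumberField.discr K) (ι : K →+* ℂ)
    {ℓ : ℕ} (hℓ : Zhang2014.IsKolyvaginPrime (W.conductorNorm ℤ) W K 2 ℓ) :
    ∃ (d : KolyvaginHeegnerData Dt β ι 1) (d' : KolyvaginHeegnerData Dt β ι (1 * ℓ)),
      (∀ l' ∈ (1 : ℕ).primeFactors, ∀ (x : ringClassField K ι 1) (x' : ringClassField K ι (1 * ℓ)),
        (x : ℂ) = x' → ((d'.σ l' x' : ringClassField K ι (1 * ℓ)) : ℂ) = (d.σ l' x : ℂ)) ∧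
      (∀ s ∈ d.S, ∃ s' ∈ d'.S, ∀ (x : ringClassField K ι 1) (x' : ringClassField K ι (1 * ℓ)),
        (x : ℂ) = x' → ((s' x' : ringClassField K ι (1 * ℓ)) : ℂ) = (s x : ℂ)) ∧
      (∀ s' ∈ d'.S, ∃ s ∈ d.S, ∀ (x : ringClassField K ι 1) (x' : ringClassField K ι (1 * ℓ)),
        (x : ℂ) = x' → ((s' x' : ringClassField K ι (1 * ℓ)) : ℂ) = (s x : ℂ)) ∧
      (∀ (x : ringClassField K ι 1) (x' : ringClassField K ι (1 * ℓ)), (x : ℂ) = x' → d'.emb x' = d.emb x) := by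
  have hprime : ℓ.Prime := hℓ.1
  have hsq : Squarefree (1 * ℓ) := by rw [one_mul]; exact hprime.prime.squarefree
  have hpf : ∀ q ∈ (1 * ℓ).primeFactors, q = ℓ := fun q hq ↦ by
    rw [one_mul, hprime.primeFactors, Finset.mem_singleton] at hq; exact hq
  have hnK : ∀ q ∈ (1 * ℓ).primeFactors, Zhang2014.IsKolyvaginPrime (W.conductorNorm ℤ) W K 2 q :=
    fun q hq ↦ by rw [hpf q hq]; exact hℓ
  have hinert : ∀ q ∈ (1 * ℓ).primeFactors, (Ideal.span {(q : 𝓞 K)}).IsPrime := fun q hq ↦ (hnK q hq).2.2.2.2.1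
  obtain ⟨d'⟩ := BirchSwinnertonDyer.Theorems.nonempty_kolyvaginHeegnerData_of_grossCM
    (phi_heegnerPointOfConductor_mem_range_map_ringClassField_holds (W.conductorNorm ℤ) W K)
    (exists_generator_ringClassGalOver_holds (K := K)) hK hH Dt β ι hβ hsq hinert
  obtain ⟨d, hσ, hS, hS', hemb⟩ :=
    JET.exists_compatible_datum_of_dvd_of_grossCM hK hD hH 2 Dt β ι hsq hnK (one_dvd _) d'
  exact ⟨d, d', hσ, hS, hS', hemb⟩

/-! ### §3 The Heegner point of the door IS `P(1)` -/

/-- **`P ↦ P(1)`**: for a conductor-`1` datum `d₁` over the frame `(Dt, H.β, ι)` of a Heegner datum `H` of discriminant `d_K` and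
`P ∈ E(K)` mapping to `heegnerPointComplex Dt H` under `ι`, the image of `P` in `E(K[1])` is the derived point `P(1) = Tr y(1)`.
Proof: `P(1)` is `Gal(K[1]/K)`-fixed, so it is the image of some `P₀ ∈ E(K)` (gk2's `exists_map_eq_of_pow_smul_eq_derivedPoint`); under
`ι`, `P₀ ↦ Σ_{s ∈ S} (s y(1))_ℂ = Σ_{Q ∈ H.reps} φ(τ_Q)` by Shimura reciprocity at conductor `1` (tree theorem
`heegnerPointOfConductor_one_galoisConj_holds`), which is the image of `P`; `E(K) → E(ℂ)` is injective.
[cite: GrossLMS1991, §4 (P_1 = Tr y_1 = y_K)] [cite: Darmon2004, Thm. 3.7] -/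
theorem map_algebraMap_eq_derivedPoint_of_heegnerPoint (W : WeierstrassCurve ℚ) [W.IsElliptic] [W.IsGloballyMinimal]
    [NeZero (W.conductorNorm ℤ)]
    (K : Type) [Field K] [NumberField K] (hK : IsImaginaryQuadratic K) (hodd : Odd (NumberField.discr K))
    (hH : SatisfiesHeegnerHypothesis (W.conductorNorm ℤ) K) (hsurj : W.HasSurjectiveModNGaloisRep ((2 : ℤ) ^ 1))
    (Dt : ModularParametrizationData W (W.conductorNorm ℤ)) (H : HeegnerDatum (W.conductorNorm ℤ) (NumberField.discr K))
    (ι : K →+* ℂ) (d : KolyvaginHeegnerData Dt H.β ι 1)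
    (P : (W.baseChange K).toAffine.Point) (hP : WeierstrassCurve.Affine.Point.map ι.toRatAlgHom P = heegnerPointComplex Dt H) :
    WeierstrassCurve.Affine.Point.map (W' := W) (algebraMap K (ringClassField K ι 1)).toRatAlgHom P = d.derivedPoint := by
  obtain ⟨P₀, hP₀⟩ := exists_map_eq_of_pow_smul_eq_derivedPoint W K hK hodd hH hsurj d (k := 0) (Q := d.derivedPoint)
    (by rw [pow_zero, Nat.cast_one, one_zsmul])
  -- under `ι`, `P₀ ↦ heegnerPointComplex Dt H`
  obtain ⟨e, he⟩ := heegnerPointOfConductor_one_galoisConj_holds (W.conductorNorm ℤ) W K hK hH Dt H.β ι d H rfl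
  have hι : ι.toRatAlgHom =
      (ringClassField K ι 1).subtype.toRatAlgHom.comp (algebraMap K (ringClassField K ι 1)).toRatAlgHom := by
    ext x
    rfl
  have hP₀C : WeierstrassCurve.Affine.Point.map ι.toRatAlgHom P₀ = heegnerPointComplex Dt H := by
    rw [hι, ← WeierstrassCurve.Affine.Point.map_map, hP₀, d.derivedPoint_one, map_sum, heegnerPointComplex,
      ← Finset.sum_coe_sort H.reps, ← Finset.sum_coe_sort d.S]
    exact Fintype.sum_equiv e _ _ fun s ↦ he s
  have hPP₀ : P = P₀ :=
    WeierstrassCurve.Affine.Point.map_injective (W' := W) ι.toRatAlgHom (hP.trans hP₀C.symm)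
  rw [hPP₀, hP₀]

/-! ### §4 `c_M(1) = κ_{2^M}(P)` -/

/-- **The bottom class is the Kummer class of the door's Heegner point**: `c_M(1) = κ_{2^M}(P)` in `H¹(K, E_K[2^M])`, for `d₁` over the
frame `(Dt, H.β, ι)` and `P ↦ heegnerPointComplex Dt H` (§3 + gk2's `kolyvaginClass_one_two_eq_kummerMapTorsion`).
[cite: GrossLMS1991, §4 (4.4)] [cite: McCallumLMS1991, §4 (6)] -/
theorem kolyvaginClass_one_eq_kummerMapTorsion_of_heegnerPoint (W : WeierstrassCurve ℚ) [W.IsElliptic] [W.IsGloballyMinimal]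
    [NeZero (W.conductorNorm ℤ)]
    (K : Type) [Field K] [NumberField K] (hK : IsImaginaryQuadratic K) (hodd : Odd (NumberField.discr K))
    (hH : SatisfiesHeegnerHypothesis (W.conductorNorm ℤ) K) (hsurj : W.HasSurjectiveModNGaloisRep ((2 : ℤ) ^ 1)) (M : ℕ)
    (Dt : ModularParametrizationData W (W.conductorNorm ℤ)) (H : HeegnerDatum (W.conductorNorm ℤ) (NumberField.discr K))
    (ι : K →+* ℂ) (d : KolyvaginHeegnerData Dt H.β ι 1)
    (P : (W.baseChange K).toAffine.Point) (hP : WeierstrassCurve.Affine.Point.map ι.toRatAlgHom P = heegnerPointComplex Dt H) :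
    d.kolyvaginClass Nat.prime_two M =
      kummerMapTorsion (W.baseChange K) ((2 ^ M : ℕ) : ℤ)
        ((W.baseChange K).zsmul_geomPoints_surjective_of_charZero (by exact_mod_cast pow_ne_zero M two_ne_zero)) P :=
  kolyvaginClass_one_two_eq_kummerMapTorsion W K hK hodd hH hsurj M d P
    (map_algebraMap_eq_derivedPoint_of_heegnerPoint W K hK hodd hH hsurj Dt H ι d P hP)

/-! ### §5 At level `2` Kolyvagin's class is both `τ`-fixed and `τ`-anti-fixed -/

/-- **At level `2`, `τ_* c(n) = c(n) = −c(n)`** for a datum at a square-free Zhang–Kolyvagin level (Gross Prop. 5.4 at `2` gives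
`τ_* c = ±c`, `KolyvaginClassSign.sign_conjAct_kolyvaginClass_two`; and `2 · c = 0` in `H¹(K, E_K[2])`).
[cite: GrossLMS1991, §5 Prop. 5.4] [cite: McCallumLMS1991, §5 (p. 303)] -/
theorem conjAct_kolyvaginClass_eq_self_and_eq_neg_two (W : WeierstrassCurve ℚ) [W.IsElliptic] [W.IsGloballyMinimal]
    [NeZero (W.conductorNorm ℤ)]
    (K : Type) [Field K] [NumberField K] (hK : IsImaginaryQuadratic K) (hD3 : NumberField.discr K ≠ -3)
    (hD4 : NumberField.discr K ≠ -4) (hodd : Odd (NumberField.discr K)) (hH : SatisfiesHeegnerHypothesis (W.conductorNorm ℤ) K)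
    (hsurj : W.HasSurjectiveModNGaloisRep ((2 : ℤ) ^ 1)) (τ : K ≃ₐ[ℚ] K) (hτ : τ ≠ 1)
    (Dt : ModularParametrizationData W (W.conductorNorm ℤ)) (β : ℤ) (ι : K →+* ℂ) {n : ℕ} (hn : Squarefree n)
    (hnK : ∀ q ∈ n.primeFactors, Zhang2014.IsKolyvaginPrime (W.conductorNorm ℤ) W K 2 q ∧ 1 ≤ Zhang2014.kolyvaginIndex W 2 q)
    (d : KolyvaginHeegnerData Dt β ι n) :
    conjAct W τ ((2 ^ 1 : ℕ) : ℤ) (d.kolyvaginClass Nat.prime_two 1) = d.kolyvaginClass Nat.prime_two 1 ∧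
      conjAct W τ ((2 ^ 1 : ℕ) : ℤ) (d.kolyvaginClass Nat.prime_two 1) = -d.kolyvaginClass Nat.prime_two 1 := by
  set c := d.kolyvaginClass Nat.prime_two 1 with hc
  -- `2c = 0`, so `-c = c`
  have h2 : ((2 ^ 1 : ℕ) : ℤ) • c = 0 := zsmul_galH1Torsion_eq_zero (W.baseChange K) _ c
  have h2' : (2 : ℤ) • c = 0 := by simpa using h2
  have hneg : -c = c := (eq_neg_of_add_eq_zero_left (by rwa [two_zsmul] at h2')).symm
  obtain ⟨hsgn, hconj⟩ := sign_conjAct_kolyvaginClass_two hK hD3 hD4 hodd hH hsurj τ hτ Dt β ι hn le_rfl hnK d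
  rcases hsgn with h1 | h1
  · rw [h1, one_smul] at hconj
    exact ⟨hconj, hconj.trans hneg.symm⟩
  · rw [h1, neg_one_zsmul] at hconj
    exact ⟨hconj.trans hneg, hconj⟩

/-! ### §6 The two descents of `c(ℓ)` to `ℚ`: on `W` and on the twist -/

/-- **The descents of a level-`2` Kolyvagin class**: on the habitat (`ρ̄_{W,2}` onto, `K = ℚ(θ)`, `θ² = d_K` odd `∉ {−3,−4}`, Heegner) there are
`u ∈ H¹(ℚ, W[2])` with `res u = c(n)` and `u' ∈ H¹(ℚ, W^{(d_K)}[2])` with `ψ(res u') = c(n)` (§5 with gk2's unique `±` descents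
`EigenClassesFinite.existsUnique_resTorsion_eq_of_conjAct_eq` / `existsUnique_hPsiKT_resTorsion_eq_of_conjAct_eq_neg`).
[cite: GrossLMS1991, §5 (5.1)] [cite: Kolyvagin1989Izv, §3 (the pair `(E, E^D)`)] -/
theorem exists_descents_kolyvaginClass_two (W : WeierstrassCurve ℚ) [W.IsElliptic] [W.IsGloballyMinimal] [NeZero (W.conductorNorm ℤ)]
    (K : Type) [Field K] [NumberField K] (hK : IsImaginaryQuadratic K) (hD3 : NumberField.discr K ≠ -3)
    (hD4 : NumberField.discr K ≠ -4) (hodd : Odd (NumberField.discr K)) (hH : SatisfiesHeegnerHypothesis (W.conductorNorm ℤ) K)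
    (hsurj : W.HasSurjectiveModNGaloisRep ((2 : ℤ) ^ 1))
    {θ : K} (hθ : θ ∉ Set.range (algebraMap ℚ K)) (hθsq : θ ^ 2 = algebraMap ℚ K ((NumberField.discr K : ℤ) : ℚ))
    (Dt : ModularParametrizationData W (W.conductorNorm ℤ)) (β : ℤ) (ι : K →+* ℂ) {n : ℕ} (hn : Squarefree n)
    (hnK : ∀ q ∈ n.primeFactors, Zhang2014.IsKolyvaginPrime (W.conductorNorm ℤ) W K 2 q ∧ 1 ≤ Zhang2014.kolyvaginIndex W 2 q)
    (d : KolyvaginHeegnerData Dt β ι n) :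
    (∃ u : galH1Torsion W ((2 ^ 1 : ℕ) : ℤ), resTorsion W K ((2 ^ 1 : ℕ) : ℤ) u = d.kolyvaginClass Nat.prime_two 1) ∧
      ∃ u' : galH1Torsion (W.quadraticTwist ((NumberField.discr K : ℤ) : ℚ)) ((2 ^ 1 : ℕ) : ℤ),
        hPsiKT W K hθ hθsq ((2 ^ 1 : ℕ) : ℤ) (resTorsion (W.quadraticTwist ((NumberField.discr K : ℤ) : ℚ)) K ((2 ^ 1 : ℕ) : ℤ) u') =
          d.kolyvaginClass Nat.prime_two 1 := by
  have h2K := hK.1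
  have hs2 : W.HasSurjectiveModNGaloisRep 2 := by rwa [pow_one] at hsurj
  have hL := forall_zsmul_two_pow_baseChange_eq_zero_of_hasSurjectiveModNGaloisRep_two W K h2K hs2 1
  obtain ⟨hfix, hanti⟩ := conjAct_kolyvaginClass_eq_self_and_eq_neg_two W K hK hD3 hD4 hodd hH hsurj (sigmaQ K h2K hθ hθsq)
    (sigmaQ_ne_one K h2K hθ hθsq) Dt β ι hn hnK d
  obtain ⟨u, hu, -⟩ := existsUnique_resTorsion_eq_of_conjAct_eq W K h2K hθ hθsq ((2 ^ 1 : ℕ) : ℤ) hL hfix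
  obtain ⟨u', hu', -⟩ := existsUnique_hPsiKT_resTorsion_eq_of_conjAct_eq_neg W K h2K hθ hθsq ((2 ^ 1 : ℕ) : ℤ) hL hanti
  exact ⟨⟨u, hu⟩, ⟨u', hu'⟩⟩

/-! ### §7 Gross 6.2 (2) at `λ ∣ ℓ` from item 24880 at `(M, m, l) = (1, 1, ℓ)` -/

/-- **Item 24880 read at the first layer**: for the compatible pair `(d₁, d_ℓ)` and the place `λ ∋ ℓ` of `K`,
`(c(ℓ) ∈ Sel_λ ↔ c(ℓ)_λ = 0) ∧ (c(ℓ)_λ = 0 ↔ c(1)_λ = 0)` at level `2` (`KolyvaginRelationAtTwo` at `M = 1`, `m = 1`, `l = ℓ`, `j = 0`).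
[cite: McCallumLMS1991, §4 Prop. 4.4 «in particular»] [cite: GrossLMS1991, Prop. 6.2 (2)] -/
theorem kolyvaginRelation_at_prime_of_item
    (hrel : Summit.BirchSwinnertonDyer.BirchSwinnertonDyer.Theses.GenusKolyvaginAtTwo.KolyvaginRelationAtTwo)
    (W : WeierstrassCurve ℚ) [W.IsElliptic] [W.IsGloballyMinimal] [NeZero (W.conductorNorm ℤ)] (hCM : ¬ W.HasCM)
    (K : Type) [Field K] [NumberField K] (hK : IsImaginaryQuadratic K) (hD3 : NumberField.discr K ≠ -3)
    (hD4 : NumberField.discr K ≠ -4) (hH : SatisfiesHeegnerHypothesis (W.conductorNorm ℤ) K)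
    (hsurj : ∀ k : ℕ, W.HasSurjectiveModNGaloisRep ((2 ^ k : ℕ) : ℤ))
    (Dt : ModularParametrizationData W (W.conductorNorm ℤ)) (β : ℤ) (ι : K →+* ℂ)
    {ℓ : ℕ} (hℓ : Zhang2014.IsKolyvaginPrime (W.conductorNorm ℤ) W K 2 ℓ) (hidx : 1 ≤ Zhang2014.kolyvaginIndex W 2 ℓ)
    (d : KolyvaginHeegnerData Dt β ι 1) (d' : KolyvaginHeegnerData Dt β ι (1 * ℓ))
    (hσ : ∀ l' ∈ (1 : ℕ).primeFactors, ∀ (x : ringClassField K ι 1) (x' : ringClassField K ι (1 * ℓ)),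
      (x : ℂ) = x' → ((d'.σ l' x' : ringClassField K ι (1 * ℓ)) : ℂ) = (d.σ l' x : ℂ))
    (hS₁ : ∀ s ∈ d.S, ∃ s' ∈ d'.S, ∀ (x : ringClassField K ι 1) (x' : ringClassField K ι (1 * ℓ)),
      (x : ℂ) = x' → ((s' x' : ringClassField K ι (1 * ℓ)) : ℂ) = (s x : ℂ))
    (hS₂ : ∀ s' ∈ d'.S, ∃ s ∈ d.S, ∀ (x : ringClassField K ι 1) (x' : ringClassField K ι (1 * ℓ)),
      (x : ℂ) = x' → ((s' x' : ringClassField K ι (1 * ℓ)) : ℂ) = (s x : ℂ))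
    (hemb : ∀ (x : ringClassField K ι 1) (x' : ringClassField K ι (1 * ℓ)), (x : ℂ) = x' → d'.emb x' = d.emb x)
    (w : HeightOneSpectrum (𝓞 K)) (hw : (ℓ : 𝓞 K) ∈ w.asIdeal) :
    (d'.kolyvaginClass Nat.prime_two 1 ∈ selmerLocalKer (W.baseChange K) (w.adicCompletion K) ((2 ^ 1 : ℕ) : ℤ) ↔
        d'.kolyvaginClass Nat.prime_two 1 ∈ (W.baseChange K).torsionLocalKer (w.adicCompletion K) ((2 ^ 1 : ℕ) : ℤ)) ∧
      (d'.kolyvaginClass Nat.prime_two 1 ∈ (W.baseChange K).torsionLocalKer (w.adicCompletion K) ((2 ^ 1 : ℕ) : ℤ) ↔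
        d.kolyvaginClass Nat.prime_two 1 ∈ (W.baseChange K).torsionLocalKer (w.adicCompletion K) ((2 ^ 1 : ℕ) : ℤ)) := by
  have hprime : ℓ.Prime := hℓ.1
  have hsq : Squarefree (1 * ℓ) := by rw [one_mul]; exact hprime.prime.squarefree
  have hlm : ¬ ℓ ∣ 1 := fun h ↦ hprime.one_lt.ne' (Nat.dvd_one.mp h)
  have hS : ∀ l' ∈ (1 * ℓ).primeFactors, Zhang2014.IsKolyvaginPrime (W.conductorNorm ℤ) W K 2 l' ∧
      1 ≤ Zhang2014.kolyvaginIndex W 2 l' := fun q hq ↦ by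
    rw [one_mul, hprime.primeFactors, Finset.mem_singleton] at hq
    subst hq
    exact ⟨hℓ, hidx⟩
  have h := hrel W hCM K hK hD3 hD4 hH hsurj Dt β ι 1 le_rfl 1 ℓ hsq hprime hlm hS d d' hσ hS₁ hS₂ hemb w hw 0
  simpa only [pow_zero, Nat.cast_one, one_zsmul] using h

end Summit.BirchSwinnertonDyer.BirchSwinnertonDyer.Theorems.RankOneAtTwoOneDoor

end
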